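import Literature.AlgebraicGeometry.HodgeTheory.AlgebraicityLocusFromMumfordVerdier
import Literature.AlgebraicGeometry.HodgeTheory.LefschetzOneOneChowClosed
import Literature.AlgebraicGeometry.Motives.PullbackOver
import Literature.AlgebraicGeometry.Motives.ClosedSubvarietyOfPoint
import Literature.AlgebraicGeometry.Resolution.BlowupRegularPoints
import Literature.AlgebraicGeometry.Resolution.SmoothOfRegularPerfectField
import Mathlib.AlgebraicGeometry.FunctionField
import HarnessLib

/-!
# Algebraicity loci: the structure theorem from Mumford's curve lemma and Verdier's theorem (general form)

Topic `Literature/AlgebraicGeometry/HodgeTheory` (family `hodge`). The named fact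
`charlesSchnell_algebraicityLocus_iUnion_closed` (`AlgebraicityLocus.lean`; Charles–Schnell,
*Notes on absolute Hodge classes*, proof of Prop. 11.3.11; Voisin, *Hodge Theory II*, §3.3.1,
§7.3.2) is proved in `AlgebraicityLocusFromMumfordVerdier` from Mumford's curve lemma (`hM`, the
tree's named fact `Motives.mumford_smoothCurve_through_two_points`) and a hypothesis `hV` phrased
for the hyperplane witness families of the proof (pair triviality of (`𝒳 ×_S T`, `𝒵`) over path
connected relative neighbourhoods). This file replaces `hV` by the GENERAL published statement it
is an instance of — Verdier's generic topological local triviality of a proper morphism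
`g : X ⟶ T` compatibly with finitely many closed subsets (J.-L. Verdier, *Stratifications de
Whitney et théorème de Bertini–Sard*, Invent. Math. 36 (1976): Thm. (2.2) Whitney
stratifications adapted to a finite family of closed algebraic subsets, Thm. (3.3) Bertini–Sard
for stratified proper maps over a dense Zariski open of the image, Thm. (4.14) the first isotopy
lemma, Cor. (5.1); Dimca 1992, Ch. 1, (3.5)–(3.6)) — stated on the tree's carriers
(`ComplexPoints`, `AlgPoints.map`, `AlgPoints.pt`) for an arbitrary proper `g : X ⟶ T`, and it
PROVES the local path-connectedness of the complex points over the generic part of an irreducible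
closed subset of the parameter scheme, which the dichotomy argument also needs:

* `exists_pullbackPointsHomeomorph`, `prodEquiv_symm_map_fst_map_snd` — the complex points of
  `𝒳 ×_S T` as the subspace `{(x, y) | f x = h y}` of `𝒳(ℂ) × T(ℂ)` and their images in `𝒳 ×_ℂ T`;
* `exists_opens_locallyPathConnectedSpace_setOf_pt_mem` — **generic local path-connectedness**:
  for `T` locally of finite type over `ℂ` and `Y ⊆ T` closed irreducible there is an open `O₁`
  meeting `Y` such that for every open `O ≤ O₁` the complex points over `Y ∩ O` form a locally
  path connected subspace of `T(ℂ)` (the reduced subscheme on `Y` is integral, its regular locus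
  is open — Matsumura, Cor. to Thm. 30.5, the tree's
  `Resolution.isOpen_regularLocus_of_locallyOfFiniteType_perfectField` — and contains the generic
  point; the regular open part is smooth over the perfect field `ℂ`,
  `Resolution.smooth_of_isRegular_of_perfectField`, so its complex points form a manifold,
  `locallyPathConnectedSpace_complexPoints_of_smooth`, embedded onto the complex points over
  `Y ∩ O` — closed immersions embed and lift complex points, open immersions are open embeddings);
* `pairTrivialisation_of_genericPairTriviality` — **the bridge**: for `f : 𝒳 ⟶ S` proper over a
  separated `S`, a parameter scheme `h : T ⟶ S` separated of finite type over `ℂ`, a closed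
  `𝒵 ⊆ 𝒳 × T` and an irreducible closed `Y ⊆ T`, Verdier's statement for the proper projection
  `𝒳 ×_S T ⟶ T` (`Motives.pullbackOver.snd`) and the closed subset `𝒵 ∩ (𝒳 ×_S T)` yields the
  hypothesis `htriv` of `dichotomy_of_pairTrivialisation` over EVERY smaller open part `Y ∩ O'`
  of the generic part: path connected trivialising relative neighbourhoods
  (`exists_opens_locallyPathConnectedSpace_setOf_pt_mem`), the trivialisations transported along
  `(𝒳 ×_S T)(ℂ) ≃ₜ {(x, y) ∈ 𝒳(ℂ) × T(ℂ) | f x = h y}` (`Motives.pullbackOver.isEmbedding_points`,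
  `range_points`) and restricted to the smaller neighbourhoods;
  `pairTrivialisation_of_genericLocalTriviality` — the same from the variant of Verdier's
  statement which also records the local path-connectedness of the generic part (Verdier (3.3):
  the open part is smooth);
* `charlesSchnell_algebraicityLocus_iUnion_closed_of_mumford_of_genericPairTriviality` — **the
  structure theorem from the two published inputs in their general printed forms**: Mumford's
  lemma `hM` and Verdier's generic local triviality of pairs `hGT` (verbatim the statement to be
  recorded as the named fact `Motives.Verdier1976_genericLocalTriviality`), via
  `charlesSchnell_algebraicityLocus_iUnion_closed_of_mumford_of_verdier`;
  `charlesSchnell_algebraicityLocus_iUnion_closed_of_mumford_of_verdier1976` — the same from the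
  variant with the local path-connectedness clause.

Everything here is proved; no named fact is introduced. Once both inputs are theorems of the
tree, `charlesSchnell_algebraicityLocus_iUnion_closed_holds` is the one-line application of
`charlesSchnell_algebraicityLocus_iUnion_closed_of_mumford_of_genericPairTriviality`.

## References

* [CharlesSchnell2014Notes] F. Charles, C. Schnell, Notes on absolute Hodge classes, in Hodge
  Theory (Princeton Math. Notes 49, 2014), Prop. 11.3.11 (proof).
* [VoisinHodgeII2003] C. Voisin, Hodge Theory and Complex Algebraic Geometry II (2003), §3.3.1,
  §7.3.2 (proof of Thm. 7.19).
* [Verdier1976] J.-L. Verdier, Stratifications de Whitney et théorème de Bertini–Sard, Invent.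
  Math. 36 (1976) 295–312, Thm. (2.2), Thm. (3.3), Thm. (4.14), Cor. (5.1).
* [Dimca1992] A. Dimca, Singularities and Topology of Hypersurfaces (1992), Ch. 1, (3.5)–(3.6).
* [MumfordAV1970] D. Mumford, Abelian Varieties (1970), §6, Lemma.
* [Matsumura1987] H. Matsumura, Commutative Ring Theory (1987), §30, Cor. to Thm. 30.5 and
  Remark 2 after Thm. 30.3.
* [Hartshorne1977] R. Hartshorne, Algebraic Geometry (1977), II.3 Thm. 3.3, II Thm. 4.9.
* [SGA1] A. Grothendieck, M. Raynaud, SGA 1, Exp. XII, Thm. 1.1 and Prop. 3.1.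
-/

noncomputable section

open CategoryTheory AlgebraicGeometry Limits Set MonoidalCategory CartesianMonoidalCategory
open _root_.Topology TopologicalSpace Filter
open Literature.AlgebraicGeometry.Motives Literature.AlgebraicGeometry.Motives.ProjectiveSpace

namespace Literature.AlgebraicGeometry.HodgeTheory

section HodgeTheory

/-! ### Complex points of a fibre product as a subspace of the product -/

section Points

variable {𝒳 S T : Motives.SchemeOver ℂ} (f : 𝒳 ⟶ S) (h : T ⟶ S)

/-- **`(𝒳 ×_S T)(ℂ) ≃ₜ {(x, y) ∈ 𝒳(ℂ) × T(ℂ) | f x = h y}`** for `S` separated over `ℂ`: the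
pair-of-projections map is a topological embedding (`Motives.pullbackOver.isEmbedding_points`:
closed immersions embed complex points, `(𝒳 ×_ℂ T)(ℂ) ≃ₜ 𝒳(ℂ) × T(ℂ)`) with image the pairs
agreeing on `S` (`Motives.pullbackOver.range_points`), so it is a homeomorphism onto that
subspace, with underlying pair `(pr₁(P), pr₂(P))`. [cite: Hartshorne1977, II.3 Thm. 3.3] -/
theorem exists_pullbackPointsHomeomorph [IsSeparated S.hom] :
    ∃ ψ : Motives.ComplexPoints (pullbackOver f h) ≃ₜ
      {p : Motives.ComplexPoints 𝒳 × Motives.ComplexPoints T //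
        AlgPoints.map f p.1 = AlgPoints.map h p.2},
      ∀ P, ((ψ P : {p : Motives.ComplexPoints 𝒳 × Motives.ComplexPoints T //
          AlgPoints.map f p.1 = AlgPoints.map h p.2}) :
        Motives.ComplexPoints 𝒳 × Motives.ComplexPoints T) =
        (AlgPoints.map (pullbackOver.fst f h) P, AlgPoints.map (pullbackOver.snd f h) P) :=
  ⟨(pullbackOver.isEmbedding_points f h ℂ).toHomeomorph.trans
    (Homeomorph.setCongr (pullbackOver.range_points f h ℂ)), fun _ => rfl⟩

/-- The point of `𝒳 ×_ℂ T` under a point `P` of `𝒳 ×_S T` (through `pullbackOver.toProd`) is the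
pair `(pr₁(P), pr₂(P))` reassembled by `AlgPoints.prodEquiv`. [folklore] -/
theorem prodEquiv_symm_map_fst_map_snd (P : Motives.ComplexPoints (pullbackOver f h)) :
    (AlgPoints.prodEquiv.symm
        (AlgPoints.map (pullbackOver.fst f h) P, AlgPoints.map (pullbackOver.snd f h) P) :
      Motives.ComplexPoints (𝒳 ⊗ T)) = AlgPoints.map (pullbackOver.toProd f h) P := by
  rw [Equiv.symm_apply_eq]
  exact (pullbackOver.coe_pointsEquiv_eq f h ℂ P)

end Points

/-! ### Generic local path-connectedness of the complex points over an irreducible closed subset -/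

section PathConnected

open Literature.AlgebraicGeometry.Resolution

variable {T : Motives.SchemeOver ℂ}

/-- **The complex points over the generic part of an irreducible closed subset are locally path
connected.** Let `T` be a `ℂ`-scheme locally of finite type and `Y ⊆ T` closed irreducible. Then
there is an open `O₁ ⊆ T` meeting `Y` such that for every open `O ≤ O₁` the subspace
`{y ∈ T(ℂ) | pt y ∈ Y ∩ O}` of `T(ℂ)` is locally path connected. Give `Y = closure {ξ}` its
reduced closed subscheme structure `W` (`Motives.ClosedSubvariety.ofPoint`), an integral scheme
locally of finite type over `ℂ`; its regular locus is open (Matsumura, Cor. to Thm. 30.5: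
`Resolution.isOpen_regularLocus_of_locallyOfFiniteType_perfectField`) and contains the generic
point (whose local ring is the function field), so it is `W ∩ O₁` for an open `O₁ ⊆ T` meeting
`Y`. For `O ≤ O₁` the open subscheme `W ∩ O` is regular (open immersions induce isomorphisms of
local rings), hence smooth over the perfect field `ℂ` (Matsumura, §30 Remark 2:
`Resolution.smooth_of_isRegular_of_perfectField`), so `(W ∩ O)(ℂ)` is a real manifold, locally
path connected (`locallyPathConnectedSpace_complexPoints_of_smooth`); and
`(W ∩ O)(ℂ) → T(ℂ)` is a topological embedding (open immersions are open embeddings of complex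
points, closed immersions are embeddings: SGA1 XII Prop. 3.1; Serre, GAGA §2) with image exactly
the complex points over `Y ∩ O` (complex points over the image of a closed immersion lift,
`range_map_eq_setOf_pt_mem_range`). [cite: Matsumura1987, §30, Cor. to Thm. 30.5 and Remark 2]
[cite: SGA1, Exp. XII Prop. 3.1] -/
theorem exists_opens_locallyPathConnectedSpace_setOf_pt_mem [LocallyOfFiniteType T.hom]
    {Y : Set T.left} (hYc : IsClosed Y) (hY : IsIrreducible Y) :
    ∃ O₁ : T.left.Opens, (Y ∩ (O₁ : Set T.left)).Nonempty ∧
      ∀ O : T.left.Opens, O ≤ O₁ →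
        LocallyPathConnectedSpace
          {y : Motives.ComplexPoints T // y.pt ∈ Y ∧ y.pt ∈ (O : Set T.left)} := by
  -- the reduced closed subscheme `W` on `Y = closure {ξ}`
  let ξ : T.left := hY.genericPoint
  let W : ClosedSubvariety T.left := ClosedSubvariety.ofPoint T.left ξ
  have hWrange : Set.range W.ι = Y := by
    rw [ClosedSubvariety.range_ofPoint_ι]
    exact hY.closure_genericPoint hYc
  let WO : Motives.SchemeOver ℂ := Over.mk (W.ι ≫ T.hom)
  let jW : WO ⟶ T := Over.homMk W.ι rfl
  haveI : IsClosedImmersion jW.left := inferInstanceAs (IsClosedImmersion W.ι)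
  have hlt : LocallyOfFiniteType (W.ι ≫ T.hom) := inferInstance
  haveI : LocallyOfFiniteType WO.hom := hlt
  -- its regular locus: open, containing the generic point (instance arguments are passed
  -- explicitly: the structure morphisms of `Over` objects have target `Spec ℂ` only up to unfolding)
  have hReg : IsOpen (Scheme.regularLocus W.carrier) :=
    @isOpen_regularLocus_of_locallyOfFiniteType_perfectField ℂ _ _ W.carrier (W.ι ≫ T.hom) hlt
  have hξReg : genericPoint W.carrier ∈ Scheme.regularLocus W.carrier := by
    change IsRegularLocalRing W.carrier.functionField
    infer_instance
  obtain ⟨O₁, hO₁, hO₁Reg⟩ := W.ι.isClosedEmbedding.isInducing.isOpen_iff.mp hReg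
  refine ⟨⟨O₁, hO₁⟩, ⟨W.ι (genericPoint W.carrier), ?_, ?_⟩, fun O hO => ?_⟩
  · rw [← hWrange]
    exact ⟨_, rfl⟩
  · change genericPoint W.carrier ∈ W.ι ⁻¹' O₁
    rw [hO₁Reg]
    exact hξReg
  -- the open subscheme `W ∩ O`, regular, hence smooth over `ℂ`
  let U : W.carrier.Opens := W.ι ⁻¹ᵁ O
  let WU : Motives.SchemeOver ℂ := openSubschemeOver WO U
  let iU : WU ⟶ WO := openSubschemeOverι WO U
  haveI : IsOpenImmersion iU.left := inferInstanceAs (IsOpenImmersion U.ι)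
  have hltU : LocallyOfFiniteType (U.ι ≫ W.ι ≫ T.hom) := inferInstance
  haveI : LocallyOfFiniteType WU.hom := hltU
  have hUreg : Scheme.IsRegular WU.left := by
    intro x
    have hx : U.ι x ∈ Scheme.regularLocus W.carrier := by
      have h1 : U.ι x ∈ (U : Set W.carrier) := by
        rw [Scheme.Opens.ι_apply]
        exact x.2
      have h2 : U.ι x ∈ W.ι ⁻¹' O₁ := hO h1
      rwa [hO₁Reg] at h2
    haveI : IsRegularLocalRing (W.carrier.presheaf.stalk (U.ι x)) := hx
    exact IsRegularLocalRing.of_ringEquiv (asIso (U.ι.stalkMap x)).commRingCatIsoToRingEquiv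
  haveI : Smooth WU.hom :=
    @smooth_of_isRegular_of_perfectField ℂ _ _ WU.left (U.ι ≫ W.ι ≫ T.hom) hltU hUreg
  haveI : LocallyPathConnectedSpace (Motives.ComplexPoints WU) :=
    locallyPathConnectedSpace_complexPoints_of_smooth WU
  -- `(W ∩ O)(ℂ) → T(ℂ)` is an embedding onto the complex points over `Y ∩ O`
  have hcomp : (AlgPoints.map (iU ≫ jW) : Motives.ComplexPoints WU → Motives.ComplexPoints T) =
      AlgPoints.map jW ∘ AlgPoints.map iU :=
    funext fun P => AlgPoints.map_comp_apply iU jW P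
  have he : IsEmbedding
      (AlgPoints.map (iU ≫ jW) : Motives.ComplexPoints WU → Motives.ComplexPoints T) := by
    rw [hcomp]
    exact (AlgPoints.isEmbedding_map_of_isClosedImmersion (L := ℂ) jW).comp
      (AlgPoints.isOpenEmbedding_map_holds (L := ℂ) iU).isEmbedding
  have hrange : Set.range
      (AlgPoints.map (iU ≫ jW) : Motives.ComplexPoints WU → Motives.ComplexPoints T) =
      {y | y.pt ∈ Y ∧ y.pt ∈ (O : Set T.left)} := by
    ext y
    constructor
    · rintro ⟨P, rfl⟩
      rw [AlgPoints.map_comp_apply]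
      refine ⟨?_, ?_⟩
      · rw [AlgPoints.pt_map, ← hWrange]
        exact ⟨_, rfl⟩
      · change W.ι (U.ι P.pt) ∈ (O : Set T.left)
        rw [Scheme.Opens.ι_apply]
        exact (P.pt).2
    · rintro ⟨hyY, hyO⟩
      have hy : y ∈ Set.range (AlgPoints.map jW : Motives.ComplexPoints WO → _) := by
        rw [range_map_eq_setOf_pt_mem_range jW]
        change y.pt ∈ Set.range W.ι
        rw [hWrange]
        exact hyY
      obtain ⟨w, rfl⟩ := hy
      have hwU : w.pt ∈ U := hyO
      have hw : w ∈ Set.range (AlgPoints.map iU : Motives.ComplexPoints WU → _) := by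
        rw [AlgPoints.range_map_of_isOpenImmersion_holds iU]
        change w.pt ∈ U.ι.opensRange
        rw [Scheme.Opens.opensRange_ι]
        exact hwU
      obtain ⟨P, rfl⟩ := hw
      exact ⟨P, AlgPoints.map_comp_apply iU jW P⟩
  let H : Motives.ComplexPoints WU ≃ₜ
      ↥{y : Motives.ComplexPoints T | y.pt ∈ Y ∧ y.pt ∈ (O : Set T.left)} :=
    he.toHomeomorph.trans (Homeomorph.setCongr hrange)
  exact H.symm.isOpenEmbedding.locallyPathConnectedSpace

end PathConnected

/-! ### The bridge: Verdier's generic local triviality ⇒ pair triviality for families of supports -/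

section Bridge

variable {𝒳 S T : Motives.SchemeOver ℂ} (f : 𝒳 ⟶ S) (h : T ⟶ S)

/-- **Pair triviality of (`𝒳 ×_S T`, `𝒵`) over small path connected relative neighbourhoods,
from Verdier's generic local triviality of pairs.** Let `f : 𝒳 ⟶ S` be proper with `S`
separated over `ℂ`, `h : T ⟶ S` with `T` separated and of finite type over `ℂ` (locally of finite
type, quasi-compact), `𝒵 ⊆ 𝒳 × T` Zariski-closed and `Y ⊆ T` closed irreducible. Assume Verdier's
theorem (Verdier 1976, (2.2) + (3.3) + (4.14), Cor. (5.1); the statement of the named fact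
`Motives.Verdier1976_genericLocalTriviality`) in the form `hGT`: for every proper `g : X ⟶ T'`
over a separated finite-type `T'`, finitely many closed `C i ⊆ X` and an irreducible closed
`Y' ⊆ T'`, there is an open `O` meeting `Y'` over whose complex points the pair
(`X(ℂ)`, `(C i)(ℂ)`) is topologically locally trivial (neighbourhoods relative to the complex
points over `Y' ∩ O`, fibre over the base point). Then there is an open `O ⊆ T` meeting `Y` such
that for EVERY open `O' ≤ O` and every complex point `y₀` over `Y ∩ O'` there are a path
connected `V ∋ y₀`, a neighbourhood of `y₀` in the complex points over `Y ∩ O'`, and a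
trivialisation `V × F₀ ≃ₜ {(v, x) ∈ V × 𝒳(ℂ) | f x = h v}` over `V` under which membership of the
corresponding point of `𝒳 × T` in `𝒵` is read off a fixed `C₀ ⊆ F₀` — exactly the hypothesis
`htriv` of `dichotomy_of_pairTrivialisation` over `Y ∩ O'`. Proof: apply `hGT` to the proper
projection `g = pr₂ : 𝒳 ×_S T ⟶ T` (base change of `f`) and the closed preimage `C` of `𝒵`
under the closed immersion `𝒳 ×_S T ⟶ 𝒳 ×_ℂ T`, intersect its open with the open `O₁` of
`exists_opens_locallyPathConnectedSpace_setOf_pt_mem`; over `O' ≤ O` shrink the trivialising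
neighbourhood to a path connected one (local path-connectedness over `Y ∩ O'`), restrict the
trivialisation, and transport it along `(𝒳 ×_S T)(ℂ) ≃ₜ {(x, y) | f x = h y}`
(`exists_pullbackPointsHomeomorph`), with fibre `F₀ = pr₂(ℂ)⁻¹(y₀)` and `C₀ = F₀ ∩ C(ℂ)`.
[cite: Verdier1976, Thm. (3.3), Thm. (4.14), Cor. (5.1)] [cite: Hartshorne1977, II.3 Thm. 3.3] -/
theorem pairTrivialisation_of_genericPairTriviality [IsProper f.left] [IsSeparated S.hom]
    [IsSeparated T.hom] [LocallyOfFiniteType T.hom] [CompactSpace T.left]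
    (hGT : ∀ ⦃X T' : Motives.SchemeOver ℂ⦄ (g : X ⟶ T'), IsSeparated T'.hom →
      LocallyOfFiniteType T'.hom → CompactSpace T'.left → IsProper g.left →
      ∀ ⦃ι : Type⦄ [Finite ι] (C : ι → Set X.left), (∀ i, IsClosed (C i)) →
      ∀ ⦃Y : Set T'.left⦄, IsClosed Y → IsIrreducible Y →
        ∃ O : T'.left.Opens, (Y ∩ (O : Set T'.left)).Nonempty ∧
          ∀ y₀ : Motives.ComplexPoints T', y₀.pt ∈ Y ∧ y₀.pt ∈ (O : Set T'.left) →
            ∃ V : Set (Motives.ComplexPoints T'),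
              V ⊆ {y | y.pt ∈ Y ∧ y.pt ∈ (O : Set T'.left)} ∧
              V ∈ 𝓝[{y | y.pt ∈ Y ∧ y.pt ∈ (O : Set T'.left)}] y₀ ∧
              ∃ φ : ↥V × {x : Motives.ComplexPoints X // AlgPoints.map g x = y₀} ≃ₜ
                  {x : Motives.ComplexPoints X // AlgPoints.map g x ∈ V},
                (∀ p, AlgPoints.map g ((φ p : {x : Motives.ComplexPoints X //
                    AlgPoints.map g x ∈ V}) : Motives.ComplexPoints X) =
                  (p.1 : Motives.ComplexPoints T')) ∧
                (∀ p i, ((φ p : {x : Motives.ComplexPoints X // AlgPoints.map g x ∈ V}) :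
                    Motives.ComplexPoints X).pt ∈ C i ↔
                  ((p.2 : {x : Motives.ComplexPoints X // AlgPoints.map g x = y₀}) :
                    Motives.ComplexPoints X).pt ∈ C i))
    (𝒵 : Set (𝒳 ⊗ T).left) (h𝒵 : IsClosed 𝒵) {Y : Set T.left} (hYc : IsClosed Y)
    (hY : IsIrreducible Y) :
    ∃ O : T.left.Opens, (Y ∩ (O : Set T.left)).Nonempty ∧
      ∀ O' : T.left.Opens, O' ≤ O →
        ∀ y₀ : Motives.ComplexPoints T, y₀.pt ∈ Y ∧ y₀.pt ∈ (O' : Set T.left) →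
        ∃ V : Set (Motives.ComplexPoints T),
          V ⊆ {y | y.pt ∈ Y ∧ y.pt ∈ (O' : Set T.left)} ∧
          V ∈ 𝓝[{y | y.pt ∈ Y ∧ y.pt ∈ (O' : Set T.left)}] y₀ ∧ IsPathConnected V ∧
          ∃ (F₀ : Type) (_ : TopologicalSpace F₀) (C₀ : Set F₀)
            (φ : ↥V × F₀ ≃ₜ {q : ↥V × Motives.ComplexPoints 𝒳 //
              AlgPoints.map f q.2 = AlgPoints.map h q.1.1}),
            (∀ x, (φ x).1.1 = x.1) ∧
            (∀ x, (AlgPoints.prodEquiv.symm ((φ x).1.2,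
                ((φ x).1.1 : Motives.ComplexPoints T)) :
                  Motives.ComplexPoints (𝒳 ⊗ T)).pt ∈ 𝒵 ↔ x.2 ∈ C₀) := by
  -- the proper projection `g : 𝒳 ×_S T ⟶ T` and the closed preimage `C` of `𝒵`
  let X : Motives.SchemeOver ℂ := pullbackOver f h
  let g : X ⟶ T := pullbackOver.snd f h
  haveI : IsProper g.left := by
    change IsProper (pullback.snd f.left h.left)
    infer_instance
  let C : Set X.left := (pullbackOver.toProd f h).left.base ⁻¹' 𝒵
  have hC : IsClosed C := h𝒵.preimage (pullbackOver.toProd f h).left.continuous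
  obtain ⟨OV, hYOV, htriv⟩ :=
    hGT g ‹_› ‹_› ‹_› ‹_› (ι := Unit) (fun _ => C) (fun _ => hC) hYc hY
  -- the generic locally path connected part
  obtain ⟨O₁, hYO₁, hlpc⟩ := exists_opens_locallyPathConnectedSpace_setOf_pt_mem (T := T) hYc hY
  have hYO : (Y ∩ ((OV ⊓ O₁ : T.left.Opens) : Set T.left)).Nonempty := by
    obtain ⟨q, hqY, hq⟩ := hY.isPreirreducible _ _ OV.2 O₁.2
      (by obtain ⟨q, hqY, hq⟩ := hYOV; exact ⟨q, hqY, hq⟩)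
      (by obtain ⟨q, hqY, hq⟩ := hYO₁; exact ⟨q, hqY, hq⟩)
    exact ⟨q, hqY, hq⟩
  refine ⟨OV ⊓ O₁, hYO, fun O' hO' y₀ hy₀ => ?_⟩
  -- the complex points over `Y ∩ OV` and over `Y ∩ O'`
  set W : Set (Motives.ComplexPoints T) := {y | y.pt ∈ Y ∧ y.pt ∈ (OV : Set T.left)} with hWdef
  set W' : Set (Motives.ComplexPoints T) := {y | y.pt ∈ Y ∧ y.pt ∈ (O' : Set T.left)} with hW'def
  have hO'V : O' ≤ OV := hO'.trans inf_le_left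
  have hO'₁ : O' ≤ O₁ := hO'.trans inf_le_right
  have hW'W : W' ⊆ W := fun y hy => ⟨hy.1, hO'V hy.2⟩
  have hy₀W : y₀.pt ∈ Y ∧ y₀.pt ∈ (OV : Set T.left) := ⟨hy₀.1, hO'V hy₀.2⟩
  obtain ⟨V, hVW, hVn, φ, hφ₁, hφ₂⟩ := htriv y₀ hy₀W
  -- a path connected neighbourhood `V' ⊆ V` of `y₀` in `W'`
  haveI : LocallyPathConnectedSpace ↥W' := hlpc O' hO'₁
  let y₀' : ↥W' := ⟨y₀, hy₀⟩
  have hU : (Subtype.val ⁻¹' V : Set ↥W') ∈ 𝓝 y₀' :=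
    preimage_coe_mem_nhds_subtype.2 (nhdsWithin_mono y₀ hW'W hVn)
  obtain ⟨V₁, ⟨hV₁n, hV₁pc⟩, hV₁U⟩ :=
    (LocallyPathConnectedSpace.path_connected_basis (X := ↥W') y₀').mem_iff.1 hU
  let V' : Set (Motives.ComplexPoints T) := Subtype.val '' V₁
  have hV'V : V' ⊆ V := by
    rintro _ ⟨v, hv, rfl⟩
    exact hV₁U hv
  have hV'W' : V' ⊆ W' := by
    rintro _ ⟨v, _, rfl⟩
    exact v.2
  have hV'n : V' ∈ 𝓝[W'] y₀ := by
    rw [nhdsWithin_eq_map_subtype_coe (s := W') (a := y₀) hy₀]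
    exact Filter.image_mem_map hV₁n
  have hV'pc : IsPathConnected V' := hV₁pc.image continuous_subtype_val
  -- the fibre over `y₀` and its closed part
  let F₀ : Type := {x : Motives.ComplexPoints X // AlgPoints.map g x = y₀}
  let C₀ : Set F₀ := {e | (e : Motives.ComplexPoints X).pt ∈ C}
  -- the points homeomorphism of the fibre product
  obtain ⟨ψ, hψ⟩ := exists_pullbackPointsHomeomorph f h
  have hψ₂ : ∀ P : Motives.ComplexPoints X, ((ψ P).1).2 = AlgPoints.map g P := fun P =>
    congrArg Prod.snd (hψ P)
  have hψ₁ : ∀ P : Motives.ComplexPoints X,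
      ((ψ P).1).1 = AlgPoints.map (pullbackOver.fst f h) P := fun P =>
    congrArg Prod.fst (hψ P)
  -- the point of `𝒳 ×_S T` in the trivialisation over `x : V' × F₀`
  let Pt : ↥V' × F₀ → Motives.ComplexPoints X := fun x => (φ (⟨x.1.1, hV'V x.1.2⟩, x.2)).1
  have hPt : ∀ x, AlgPoints.map g (Pt x) = x.1.1 := fun x => hφ₁ (⟨x.1.1, hV'V x.1.2⟩, x.2)
  have hPtc : Continuous Pt :=
    continuous_subtype_val.comp (φ.continuous.comp (by fun_prop))
  -- the forward map
  let toF : ↥V' × F₀ → {q : ↥V' × Motives.ComplexPoints 𝒳 //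
      AlgPoints.map f q.2 = AlgPoints.map h q.1.1} := fun x =>
    ⟨(x.1, AlgPoints.map (pullbackOver.fst f h) (Pt x)), by
      change AlgPoints.map f (AlgPoints.map (pullbackOver.fst f h) (Pt x)) =
        AlgPoints.map h (x.1 : Motives.ComplexPoints T)
      rw [← AlgPoints.map_comp_apply, pullbackOver.condition, AlgPoints.map_comp_apply]
      exact congrArg (AlgPoints.map h) (hPt x)⟩
  have htoFc : Continuous toF := by
    refine Continuous.subtype_mk (continuous_fst.prodMk ?_) _
    exact (AlgPoints.continuous_map _).comp hPtc
  -- the point of `𝒳 ×_S T` attached to `q`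
  let Qt : {q : ↥V' × Motives.ComplexPoints 𝒳 // AlgPoints.map f q.2 = AlgPoints.map h q.1.1} →
      Motives.ComplexPoints X := fun q =>
    ψ.symm ⟨(q.1.2, (q.1.1 : Motives.ComplexPoints T)), q.2⟩
  have hQt : ∀ q, ψ (Qt q) = ⟨(q.1.2, (q.1.1 : Motives.ComplexPoints T)), q.2⟩ := fun q =>
    ψ.apply_symm_apply _
  have hQtg : ∀ q, AlgPoints.map g (Qt q) = (q.1.1 : Motives.ComplexPoints T) := fun q => by
    rw [← hψ₂, hQt]
  have hQt₁ : ∀ q, AlgPoints.map (pullbackOver.fst f h) (Qt q) = q.1.2 := fun q => by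
    rw [← hψ₁, hQt]
  have hQtc : Continuous Qt := ψ.symm.continuous.comp (by fun_prop)
  -- the inverse map
  let invF : {q : ↥V' × Motives.ComplexPoints 𝒳 // AlgPoints.map f q.2 = AlgPoints.map h q.1.1} →
      ↥V' × F₀ := fun q =>
    (q.1.1, (φ.symm ⟨Qt q, by rw [hQtg]; exact hV'V q.1.1.2⟩).2)
  have hinvFc : Continuous invF := by
    refine (continuous_fst.comp continuous_subtype_val).prodMk ?_
    exact continuous_snd.comp (φ.symm.continuous.comp (hQtc.subtype_mk _))
  -- the first component of `φ.symm` is the image under `g`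
  have hφsymm₁ : ∀ z : {x : Motives.ComplexPoints X // AlgPoints.map g x ∈ V},
      ((φ.symm z).1 : Motives.ComplexPoints T) = AlgPoints.map g (z : Motives.ComplexPoints X) :=
    fun z => by
    conv_rhs => rw [← φ.apply_symm_apply z]
    exact (hφ₁ (φ.symm z)).symm
  have hleft : Function.LeftInverse invF toF := by
    rintro ⟨v, e⟩
    have hQ : Qt (toF (v, e)) = Pt (v, e) := by
      apply ψ.injective
      rw [hQt]
      apply Subtype.ext
      rw [hψ]
      exact Prod.ext rfl (hPt (v, e)).symm
    have hz : (⟨Qt (toF (v, e)), by rw [hQtg]; exact hV'V (toF (v, e)).1.1.2⟩ :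
        {x : Motives.ComplexPoints X // AlgPoints.map g x ∈ V}) =
        φ (⟨v.1, hV'V v.2⟩, e) := Subtype.ext hQ
    change ((toF (v, e)).1.1, (φ.symm ⟨Qt (toF (v, e)), _⟩).2) = (v, e)
    rw [hz, φ.symm_apply_apply]
  have hright : Function.RightInverse invF toF := by
    intro q
    have hv : (⟨(invF q).1.1, hV'V (invF q).1.2⟩ : ↥V) =
        (φ.symm ⟨Qt q, by rw [hQtg]; exact hV'V q.1.1.2⟩).1 := by
      apply Subtype.ext
      rw [hφsymm₁, hQtg]
    have hP : Pt (invF q) = Qt q := by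
      change (φ (⟨(invF q).1.1, hV'V (invF q).1.2⟩, (invF q).2)).1 = Qt q
      rw [hv]
      change (φ (φ.symm ⟨Qt q, _⟩)).1 = Qt q
      rw [φ.apply_symm_apply]
    apply Subtype.ext
    change ((invF q).1, AlgPoints.map (pullbackOver.fst f h) (Pt (invF q))) = q.1
    rw [hP, hQt₁]
  let Φ : ↥V' × F₀ ≃ₜ {q : ↥V' × Motives.ComplexPoints 𝒳 //
      AlgPoints.map f q.2 = AlgPoints.map h q.1.1} :=
    { toFun := toF
      invFun := invF
      left_inv := hleft
      right_inv := hright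
      continuous_toFun := htoFc
      continuous_invFun := hinvFc }
  refine ⟨V', hV'W', hV'n, hV'pc, F₀, inferInstance, C₀, Φ, fun x => rfl, fun x => ?_⟩
  -- membership in `𝒵` is read off `C₀`
  change (AlgPoints.prodEquiv.symm (AlgPoints.map (pullbackOver.fst f h) (Pt x),
      ((x.1 : ↥V') : Motives.ComplexPoints T)) : Motives.ComplexPoints (𝒳 ⊗ T)).pt ∈ 𝒵 ↔
    x.2 ∈ C₀
  rw [← hPt x, prodEquiv_symm_map_fst_map_snd, AlgPoints.pt_map]
  exact hφ₂ (⟨x.1.1, hV'V x.1.2⟩, x.2) ()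


/-- **Pair triviality from the variant of Verdier's statement recording the local
path-connectedness of the generic part** (Verdier (3.3): the dense open part `U` of the image is
a smooth subvariety, so `U(ℂ)` is a manifold): forget that clause and apply
`pairTrivialisation_of_genericPairTriviality`.
[cite: Verdier1976, Thm. (3.3), Thm. (4.14), Cor. (5.1)] -/
theorem pairTrivialisation_of_genericLocalTriviality [IsProper f.left] [IsSeparated S.hom]
    [IsSeparated T.hom] [LocallyOfFiniteType T.hom] [CompactSpace T.left]
    (hGT : ∀ ⦃X T' : Motives.SchemeOver ℂ⦄ (g : X ⟶ T'), IsSeparated T'.hom →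
      LocallyOfFiniteType T'.hom → CompactSpace T'.left → IsProper g.left →
      ∀ ⦃ι : Type⦄ [Finite ι] (C : ι → Set X.left), (∀ i, IsClosed (C i)) →
      ∀ ⦃Y : Set T'.left⦄, IsClosed Y → IsIrreducible Y →
        ∃ O : T'.left.Opens, (Y ∩ (O : Set T'.left)).Nonempty ∧
          LocallyPathConnectedSpace
            {y : Motives.ComplexPoints T' // y.pt ∈ Y ∧ y.pt ∈ (O : Set T'.left)} ∧
          ∀ y₀ : Motives.ComplexPoints T', y₀.pt ∈ Y ∧ y₀.pt ∈ (O : Set T'.left) →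
            ∃ V : Set (Motives.ComplexPoints T'),
              V ⊆ {y | y.pt ∈ Y ∧ y.pt ∈ (O : Set T'.left)} ∧
              V ∈ 𝓝[{y | y.pt ∈ Y ∧ y.pt ∈ (O : Set T'.left)}] y₀ ∧
              ∃ φ : ↥V × {x : Motives.ComplexPoints X // AlgPoints.map g x = y₀} ≃ₜ
                  {x : Motives.ComplexPoints X // AlgPoints.map g x ∈ V},
                (∀ p, AlgPoints.map g ((φ p : {x : Motives.ComplexPoints X //
                    AlgPoints.map g x ∈ V}) : Motives.ComplexPoints X) =
                  (p.1 : Motives.ComplexPoints T')) ∧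
                (∀ p i, ((φ p : {x : Motives.ComplexPoints X // AlgPoints.map g x ∈ V}) :
                    Motives.ComplexPoints X).pt ∈ C i ↔
                  ((p.2 : {x : Motives.ComplexPoints X // AlgPoints.map g x = y₀}) :
                    Motives.ComplexPoints X).pt ∈ C i))
    (𝒵 : Set (𝒳 ⊗ T).left) (h𝒵 : IsClosed 𝒵) {Y : Set T.left} (hYc : IsClosed Y)
    (hY : IsIrreducible Y) :
    ∃ O : T.left.Opens, (Y ∩ (O : Set T.left)).Nonempty ∧
      ∀ O' : T.left.Opens, O' ≤ O →
        ∀ y₀ : Motives.ComplexPoints T, y₀.pt ∈ Y ∧ y₀.pt ∈ (O' : Set T.left) →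
        ∃ V : Set (Motives.ComplexPoints T),
          V ⊆ {y | y.pt ∈ Y ∧ y.pt ∈ (O' : Set T.left)} ∧
          V ∈ 𝓝[{y | y.pt ∈ Y ∧ y.pt ∈ (O' : Set T.left)}] y₀ ∧ IsPathConnected V ∧
          ∃ (F₀ : Type) (_ : TopologicalSpace F₀) (C₀ : Set F₀)
            (φ : ↥V × F₀ ≃ₜ {q : ↥V × Motives.ComplexPoints 𝒳 //
              AlgPoints.map f q.2 = AlgPoints.map h q.1.1}),
            (∀ x, (φ x).1.1 = x.1) ∧
            (∀ x, (AlgPoints.prodEquiv.symm ((φ x).1.2,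
                ((φ x).1.1 : Motives.ComplexPoints T)) :
                  Motives.ComplexPoints (𝒳 ⊗ T)).pt ∈ 𝒵 ↔ x.2 ∈ C₀) := by
  refine pairTrivialisation_of_genericPairTriviality f h ?_ 𝒵 h𝒵 hYc hY
  intro X T' g h₁ h₂ h₃ h₄ ι _ C hC Y' hY'c hY'
  obtain ⟨O, hO, -, htriv⟩ := hGT g h₁ h₂ h₃ h₄ C hC hY'c hY'
  exact ⟨O, hO, htriv⟩

end Bridge

/-! ### The structure theorem from the two published inputs -/

section Capstone

/-- **The structure theorem on algebraicity loci from Mumford's curve lemma and Verdier's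
generic local triviality of pairs, both in their general forms.** The named fact
`charlesSchnell_algebraicityLocus_iUnion_closed` (Charles–Schnell 2014, proof of Prop. 11.3.11;
Voisin, *Hodge Theory II*, §3.3.1 and §7.3.2: for a smooth projective family `f : 𝒳 ⟶ S` over a
smooth quasi-projective base with `𝒳` quasi-projective and `A ∈ H²ᵖ(𝒳(ℂ); ℂ)`, the algebraicity
locus of `A` is `⋃_j W_j(ℂ)` for countably many Zariski-closed `W_j ⊆ S`) follows from

* `hM` — any two points of an irreducible variety lie on an irreducible curve (Mumford, *Abelian
  Varieties*, §6 Lemma; the tree's named fact `Motives.mumford_smoothCurve_through_two_points`);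
* `hGT` — Verdier's generic topological local triviality of a proper morphism `g : X ⟶ T` of
  `ℂ`-schemes (`T` separated of finite type) compatibly with finitely many closed subsets, over
  the complex points of a non-empty open part of any irreducible closed `Y ⊆ T` (Verdier 1976,
  Thm. (2.2) + Thm. (3.3) + Thm. (4.14), Cor. (5.1); Dimca 1992 Ch. 1 (3.5)–(3.6); verbatim the
  statement of the named fact `Motives.Verdier1976_genericLocalTriviality`).

Proof: `charlesSchnell_algebraicityLocus_iUnion_closed_of_mumford_of_verdier`, whose second
input (pair triviality for the hyperplane witness families `hyperplaneFamily f ε d m`, whose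
parameter schemes are proper over the quasi-projective `S`, hence separated of finite type over
`ℂ` with Noetherian underlying space) is `pairTrivialisation_of_genericPairTriviality`.
[cite: CharlesSchnell2014Notes, Prop. 11.3.11 (proof)] [cite: VoisinHodgeII2003, §3.3.1 and §7.3.2]
[cite: Verdier1976, Thm. (3.3), Thm. (4.14), Cor. (5.1)] [cite: MumfordAV1970, §6, Lemma] -/
theorem charlesSchnell_algebraicityLocus_iUnion_closed_of_mumford_of_genericPairTriviality
    (hM : Motives.mumford_smoothCurve_through_two_points)
    (hGT : ∀ ⦃X T' : Motives.SchemeOver ℂ⦄ (g : X ⟶ T'), IsSeparated T'.hom →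
      LocallyOfFiniteType T'.hom → CompactSpace T'.left → IsProper g.left →
      ∀ ⦃ι : Type⦄ [Finite ι] (C : ι → Set X.left), (∀ i, IsClosed (C i)) →
      ∀ ⦃Y : Set T'.left⦄, IsClosed Y → IsIrreducible Y →
        ∃ O : T'.left.Opens, (Y ∩ (O : Set T'.left)).Nonempty ∧
          ∀ y₀ : Motives.ComplexPoints T', y₀.pt ∈ Y ∧ y₀.pt ∈ (O : Set T'.left) →
            ∃ V : Set (Motives.ComplexPoints T'),
              V ⊆ {y | y.pt ∈ Y ∧ y.pt ∈ (O : Set T'.left)} ∧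
              V ∈ 𝓝[{y | y.pt ∈ Y ∧ y.pt ∈ (O : Set T'.left)}] y₀ ∧
              ∃ φ : ↥V × {x : Motives.ComplexPoints X // AlgPoints.map g x = y₀} ≃ₜ
                  {x : Motives.ComplexPoints X // AlgPoints.map g x ∈ V},
                (∀ p, AlgPoints.map g ((φ p : {x : Motives.ComplexPoints X //
                    AlgPoints.map g x ∈ V}) : Motives.ComplexPoints X) =
                  (p.1 : Motives.ComplexPoints T')) ∧
                (∀ p i, ((φ p : {x : Motives.ComplexPoints X // AlgPoints.map g x ∈ V}) :
                    Motives.ComplexPoints X).pt ∈ C i ↔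
                  ((p.2 : {x : Motives.ComplexPoints X // AlgPoints.map g x = y₀}) :
                    Motives.ComplexPoints X).pt ∈ C i)) :
    charlesSchnell_algebraicityLocus_iUnion_closed := by
  refine charlesSchnell_algebraicityLocus_iUnion_closed_of_mumford_of_verdier hM ?_
  intro 𝒳 S f n h𝒳 hS hSsm hfam N ε hε d m Y hYc hY
  -- the standing instances
  haveI : Smooth S.hom := hSsm
  haveI : IsProper f.left := hfam.isProper
  haveI : IsSeparated S.hom := by
    obtain ⟨P', j', hP', hj'⟩ := hS
    haveI : IsProper P'.hom := hP'.isProper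
    rw [show S.hom = j'.left ≫ P'.hom from (Over.w j').symm]
    infer_instance
  haveI : IsProper (hyperplaneFamily f ε d m).h.left := isProper_hyperplaneFamily_h f ε d m
  haveI : IsSeparated (hyperplaneFamily f ε d m).T.hom := by
    rw [← Over.w (hyperplaneFamily f ε d m).h]
    infer_instance
  haveI : LocallyOfFiniteType (hyperplaneFamily f ε d m).T.hom := by
    rw [← Over.w (hyperplaneFamily f ε d m).h]
    infer_instance
  haveI : NoetherianSpace (hyperplaneFamily f ε d m).T.left :=
    noetherianSpace_of_isProper_of_isQuasiProjectiveOver (hyperplaneFamily f ε d m).h hS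
  exact pairTrivialisation_of_genericPairTriviality f (hyperplaneFamily f ε d m).h hGT
    (hyperplaneFamily f ε d m).𝒵 (isClosed_hyperplaneFamily_𝒵 f ε d m) hYc hY

/-- **The structure theorem from the variant of Verdier's statement which also records the
local path-connectedness of the generic part**: forget that clause.
[cite: CharlesSchnell2014Notes, Prop. 11.3.11 (proof)] [cite: Verdier1976, Thm. (3.3), Thm. (4.14), Cor. (5.1)]
[cite: MumfordAV1970, §6, Lemma] -/
theorem charlesSchnell_algebraicityLocus_iUnion_closed_of_mumford_of_verdier1976
    (hM : Motives.mumford_smoothCurve_through_two_points)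
    (hGT : ∀ ⦃X T' : Motives.SchemeOver ℂ⦄ (g : X ⟶ T'), IsSeparated T'.hom →
      LocallyOfFiniteType T'.hom → CompactSpace T'.left → IsProper g.left →
      ∀ ⦃ι : Type⦄ [Finite ι] (C : ι → Set X.left), (∀ i, IsClosed (C i)) →
      ∀ ⦃Y : Set T'.left⦄, IsClosed Y → IsIrreducible Y →
        ∃ O : T'.left.Opens, (Y ∩ (O : Set T'.left)).Nonempty ∧
          LocallyPathConnectedSpace
            {y : Motives.ComplexPoints T' // y.pt ∈ Y ∧ y.pt ∈ (O : Set T'.left)} ∧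
          ∀ y₀ : Motives.ComplexPoints T', y₀.pt ∈ Y ∧ y₀.pt ∈ (O : Set T'.left) →
            ∃ V : Set (Motives.ComplexPoints T'),
              V ⊆ {y | y.pt ∈ Y ∧ y.pt ∈ (O : Set T'.left)} ∧
              V ∈ 𝓝[{y | y.pt ∈ Y ∧ y.pt ∈ (O : Set T'.left)}] y₀ ∧
              ∃ φ : ↥V × {x : Motives.ComplexPoints X // AlgPoints.map g x = y₀} ≃ₜ
                  {x : Motives.ComplexPoints X // AlgPoints.map g x ∈ V},
                (∀ p, AlgPoints.map g ((φ p : {x : Motives.ComplexPoints X //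
                    AlgPoints.map g x ∈ V}) : Motives.ComplexPoints X) =
                  (p.1 : Motives.ComplexPoints T')) ∧
                (∀ p i, ((φ p : {x : Motives.ComplexPoints X // AlgPoints.map g x ∈ V}) :
                    Motives.ComplexPoints X).pt ∈ C i ↔
                  ((p.2 : {x : Motives.ComplexPoints X // AlgPoints.map g x = y₀}) :
                    Motives.ComplexPoints X).pt ∈ C i)) :
    charlesSchnell_algebraicityLocus_iUnion_closed := by
  refine charlesSchnell_algebraicityLocus_iUnion_closed_of_mumford_of_genericPairTriviality hM ?_
  intro X T' g h₁ h₂ h₃ h₄ ι _ C hC Y' hY'c hY'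
  obtain ⟨O, hO, -, htriv⟩ := hGT g h₁ h₂ h₃ h₄ C hC hY'c hY'
  exact ⟨O, hO, htriv⟩

end Capstone

end HodgeTheory

end Literature.AlgebraicGeometry.HodgeTheory

end
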